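import Summits.ValiantsHypothesis.ValiantsHypothesis.Theorems.BarrierLeverNaturalProofsSeparateVNPBorder
import Summits.ValiantsHypothesis.ValiantsHypothesis.Theorems.BarrierLeverNaturalProofsSeparateVNPLevel
import Summits.ValiantsHypothesis.ValiantsHypothesis.Theorems.BarrierLeverNaturalProofsSeparateVNPSignSlice

/-!
# Route BarrierLever — item `NaturalProofsSeparateVNP` (stmt-ValiantsHypothesis-18972):
# algebraically natural proofs against `VP` ASCEND ALONG PROJECTIONS
# (cell valiant-natproofs, seat val-np-p4; bears on ladder rung V4)

`S := Theses.BarrierLever.NaturalProofsSeparateVNP` — "for one definability exponent `b₁`, for every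
size exponent `b`, infinitely often in `n`, a level-one algebraically natural proof against
`SmallCircuits ℂ n b` is nonzero at SOME member of the `VNP`-succinct class `SmallDefinable ℂ n b₁`"
— is the negative horn of the cell's win–win (under exponential hardness of the permanent it is the
negation of FSV Question 6, the crux item 14610; `…NaturalProofsSeparateVNPStatus`).  This file is
the engine of the PERMANENT NORMAL FORM of the item (sequel `…NaturalProofsSeparateVNPPermanent`:
`S ↔ NaturalProofAgainstVP ℂ 2 (per_⌊√n⌋ framed in n variables)`): a transfer principle for the
barrier catalogue's technique class (`Literature/Barriers/ValiantsHypothesis/AlgebraicNaturalProofs.lean`)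

  `NaturalProofAgainstVP ℂ a h := ∀ b n₀, ∃ n ≥ n₀, ∃ D ∈ Distinguishers ℂ n a` vanishing on
  `coeff(SmallCircuits ℂ n b)` with `D(coeff h_n) ≠ 0`.

* `Projections.exists_pullback` — **the coefficient map of a substitution is linear, window by
  window.**  For a substitution `a` of the `n'` frame variables by polynomials in `n` variables and
  a polynomial `D` in the `N = C(2n,n)` window-`n` coefficient variables there is `D'` in the
  `N' = C(2n',n')` window-`n'` coefficient variables with `D'(coeff P) = D(coeff P(a))` for all `P`
  of degree `≤ n'`, `L(D') ≤ L(D) + 2NN'` (substitute `N` linear forms of `N'` terms each,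
  Bürgisser 2000 Rem. 2.7 = the tree's `complexity_aeval_le`) and `deg D' ≤ deg D`.
* `Projections.naturalProofAgainstVP_of_projections` — **natural proofs against `VP` ascend along
  Valiant projections.**  If `h` carries a level-`a` natural proof against `VP` and each `h_n` is a
  projection of a member `P_{n'}` of another family at a polynomially larger frame
  (`n < n' ≤ A(n+1)^B`, `deg P_{n'} ≤ n'`), then `P` carries a level-`max a 2` natural proof
  against `VP`: the pulled-back distinguisher still vanishes on `SmallCircuits ℂ n' b`, because a
  projection of a size-`n'^b` polynomial has size `≤ n'^b` (projections are free) and its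
  window-`n` coefficients are those of its cheap degree-`n` truncation
  (`Border.truncation_mem_smallCircuits`, BCS 1997 Lemma (21.25)) — the proof for `h` is queried at
  size exponent `Bb + 3`.  Level `1 ↦ 2` pays for the `N` linear forms of `N'` terms
  (`level_budget`: `N^a + 2NN' ≤ N'^{max a 2}` since `N' ≥ 3N`, `three_mul_centralBinom_le`).
  This is the contrapositive of "`VP` is closed under p-projections" at the level of algebraically
  natural proofs (GKSS 2017 §2, FSV 2018 §1.2: folklore); `naturalProofAgainstVP_mono` records
  monotonicity in the level.

WHAT THIS IS NOT: item 18972 stays OPEN (parked on the crux, item 14610); nothing here is evidence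
for `VP ≠ VNP`, for FSV Question 6 either way, or for any hardness of the permanent.

References: [ForbesShpilkaVolk2018] Def. 1, §1.2, Cor. 5; [Burgisser2000] Def. 2.6, Rem. 2.7;
[BurgisserClausenShokrollahi1997] Lemma (21.25); [GrochowKumarSaksSaraf2017] §2.
-/

-- layout Summits/ValiantsHypothesis/ValiantsHypothesis forces the duplicated namespace component
set_option linter.dupNamespace false

noncomputable section

namespace Summit.ValiantsHypothesis.ValiantsHypothesis.Theorems.BarrierLever.NaturalProofsSeparateVNP

open Literature.Barriers.ValiantsHypothesis Literature.Computability.AlgebraicComplexity MvPolynomial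
open Summit.ValiantsHypothesis.ValiantsHypothesis.Theses

namespace Projections

/-! ### 1. Pulling a distinguisher back along a substitution of the variables -/

section Pullback

/-- A polynomial of degree `≤ n'` in `n'` variables is the sum of its terms over the window
`degLEMonomials n'`. [folklore] -/
theorem eq_sum_monomial_of_totalDegree_le {n' : ℕ} {P : MvPolynomial (Fin n') ℂ}
    (hP : P.totalDegree ≤ n') :
    P = ∑ ν : degLEMonomials n', monomial (ν : Fin n' →₀ ℕ) (coeff (ν : Fin n' →₀ ℕ) P) := by
  classical
  have hsub : P.support ⊆ (degLEMonomials n').toFinset := by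
    intro ν hν
    rw [Set.mem_toFinset]
    show ν.degree ≤ n'
    have h := (le_totalDegree hν).trans hP
    simpa [Finsupp.degree_apply, Finsupp.sum] using h
  rw [← Finset.sum_subtype (degLEMonomials n').toFinset (fun ν => Set.mem_toFinset)
    (fun ν => monomial ν (coeff ν P))]
  rw [← Finset.sum_subset hsub (fun ν _ hν => by rw [notMem_support_iff.mp hν, monomial_zero])]
  exact P.as_sum

/-- **The coefficient map of a substitution is linear, window by window.** For a substitution
`a : x'_i ↦ a i` of the `n'` frame variables by polynomials in `n` variables, the linear forms
`Φ μ = Σ_ν coeff_μ(a^ν) · c_ν` (`ν` over `degLEMonomials n'`) in the coefficient variables of the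
big frame compute the window-`n` coefficients of `P(a)` from the window-`n'` coefficients of `P`,
for every `P` of degree `≤ n'`. [folklore] -/
theorem eval_coeffVector_linForm {n n' : ℕ} (a : Fin n' → MvPolynomial (Fin n) ℂ)
    {P : MvPolynomial (Fin n') ℂ} (hP : P.totalDegree ≤ n') (μ : degLEMonomials n) :
    eval (coeffVector (degLEMonomials n') P)
        (∑ ν : degLEMonomials n',
          C (coeff (μ : Fin n →₀ ℕ) (aeval a (monomial (ν : Fin n' →₀ ℕ) (1 : ℂ)))) * X ν) =
      coeff (μ : Fin n →₀ ℕ) (aeval a P) := by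
  conv_rhs => rw [eq_sum_monomial_of_totalDegree_le hP]
  rw [map_sum, map_sum, coeff_sum]
  refine Finset.sum_congr rfl fun ν _ => ?_
  have hmon : monomial (ν : Fin n' →₀ ℕ) (coeff (ν : Fin n' →₀ ℕ) P) =
      coeff (ν : Fin n' →₀ ℕ) P • monomial (ν : Fin n' →₀ ℕ) (1 : ℂ) := by
    rw [smul_monomial, smul_eq_mul, mul_one]
  rw [map_mul, eval_C, eval_X, coeffVector_apply, hmon, map_smul, coeff_smul, smul_eq_mul, mul_comm]

/-- **Pull-back of a distinguisher along a substitution (existence form).** For every substitution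
`a` of the `n'` frame variables by polynomials in `n` variables and every polynomial `D` in the
`N = C(2n,n)` window-`n` coefficient variables there is a polynomial `D'` in the `N' = C(2n',n')`
window-`n'` coefficient variables with `D'(coeff P) = D(coeff P(a))` for all `P` of degree `≤ n'`,
of circuit size `≤ L(D) + 2 N N'` (substitute the `N` linear forms, each of `N'` terms) and of
degree `≤ deg D`. (Mumford, Red Book I §2: linear maps are morphisms; Bürgisser 2000 Rem. 2.7 for
the size of a substitution.) [folklore] -/
theorem exists_pullback {n n' : ℕ} (a : Fin n' → MvPolynomial (Fin n) ℂ)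
    (D : MvPolynomial (degLEMonomials n) ℂ) :
    ∃ D' : MvPolynomial (degLEMonomials n') ℂ,
      (∀ P : MvPolynomial (Fin n') ℂ, P.totalDegree ≤ n' →
        eval (coeffVector (degLEMonomials n') P) D' =
          eval (coeffVector (degLEMonomials n) (aeval a P)) D) ∧
      complexity D' ≤ complexity D + 2 * (2 * n).choose n * (2 * n').choose n' ∧
      D'.totalDegree ≤ D.totalDegree := by
  classical
  set Φ : degLEMonomials n → MvPolynomial (degLEMonomials n') ℂ := fun μ =>
    ∑ ν : degLEMonomials n',
      C (coeff (μ : Fin n →₀ ℕ) (aeval a (monomial (ν : Fin n' →₀ ℕ) (1 : ℂ)))) * X ν with hΦ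
  refine ⟨aeval Φ D, fun P hP => ?_, ?_, ?_⟩
  · -- the identity
    have hfun : (fun μ => aeval (coeffVector (degLEMonomials n') P) (Φ μ)) =
        coeffVector (degLEMonomials n) (aeval a P) := by
      funext μ
      rw [aeval_eq_eval, hΦ, eval_coeffVector_linForm a hP μ, coeffVector_apply]
    rw [← aeval_eq_eval (coeffVector (degLEMonomials n') P), ← AlgHom.comp_apply, comp_aeval, hfun,
      aeval_eq_eval]
  · -- the size
    have hterm : ∀ (μ : degLEMonomials n) (ν : degLEMonomials n'),
        complexity (C (coeff (μ : Fin n →₀ ℕ) (aeval a (monomial (ν : Fin n' →₀ ℕ) (1 : ℂ)))) *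
          (X ν : MvPolynomial (degLEMonomials n') ℂ)) ≤ 1 := fun μ ν =>
      calc _ ≤ complexity (C (coeff (μ : Fin n →₀ ℕ) (aeval a (monomial (ν : Fin n' →₀ ℕ) (1 : ℂ)))) :
              MvPolynomial (degLEMonomials n') ℂ) +
            complexity (X ν : MvPolynomial (degLEMonomials n') ℂ) + 1 := complexity_mul_le_holds _ _
        _ = 1 := by rw [complexity_C_holds, complexity_X_holds]
    have hΦc : ∀ μ, complexity (Φ μ) ≤ 2 * (2 * n').choose n' := fun μ => by
      rw [hΦ]
      calc _ ≤ ∑ ν : degLEMonomials n', complexity (C (coeff (μ : Fin n →₀ ℕ)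
              (aeval a (monomial (ν : Fin n' →₀ ℕ) (1 : ℂ)))) * (X ν : MvPolynomial (degLEMonomials n') ℂ)) +
            (Finset.univ : Finset (degLEMonomials n')).card := complexity_finset_sum_le _ _
        _ ≤ ∑ _ν : degLEMonomials n', 1 + (Finset.univ : Finset (degLEMonomials n')).card :=
            Nat.add_le_add_right (Finset.sum_le_sum fun ν _ => hterm μ ν) _
        _ = 2 * (2 * n').choose n' := by
            rw [Finset.sum_const, smul_eq_mul, mul_one, Finset.card_univ, SignSlice.fintypeCard_degLEMonomials]; ring
    calc complexity (aeval Φ D) ≤ complexity D + ∑ μ, complexity (Φ μ) := complexity_aeval_le _ _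
      _ ≤ complexity D + ∑ _μ : degLEMonomials n, 2 * (2 * n').choose n' :=
          Nat.add_le_add_left (Finset.sum_le_sum fun μ _ => hΦc μ) _
      _ = complexity D + 2 * (2 * n).choose n * (2 * n').choose n' := by
          rw [Finset.sum_const, smul_eq_mul, Finset.card_univ, SignSlice.fintypeCard_degLEMonomials]; ring
  · -- the degree
    have hΦd : ∀ μ, (Φ μ).totalDegree ≤ 1 := fun μ => by
      rw [hΦ]
      refine totalDegree_finsetSum_le fun ν _ => ?_
      calc _ ≤ (C (coeff (μ : Fin n →₀ ℕ) (aeval a (monomial (ν : Fin n' →₀ ℕ) (1 : ℂ)))) :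
              MvPolynomial (degLEMonomials n') ℂ).totalDegree +
            (X ν : MvPolynomial (degLEMonomials n') ℂ).totalDegree := totalDegree_mul _ _
        _ ≤ 0 + 1 := Nat.add_le_add (by rw [totalDegree_C]) (totalDegree_X ν).le
        _ = 1 := rfl
    calc (aeval Φ D).totalDegree ≤ D.totalDegree * 1 :=
          Literature.RingTheory.Nullstellensatz.totalDegree_aeval_le Φ hΦd D
      _ = D.totalDegree := mul_one _

end Pullback

/-! ### 2. Natural proofs against `VP` ascend along projections -/

section Transfer

/-- Growth of the number of coefficient variables: `C(2n', n') ≥ 3 · C(2n, n)` for `1 ≤ n < n'`.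
[folklore] -/
theorem three_mul_centralBinom_le {n n' : ℕ} (hn : 1 ≤ n) (hnn' : n < n') :
    3 * (2 * n).choose n ≤ (2 * n').choose n' := by
  have hstep : 3 * (2 * n).choose n ≤ (2 * (n + 1)).choose (n + 1) := by
    have key := Nat.succ_mul_centralBinom_succ n
    rw [Nat.centralBinom_eq_two_mul_choose, Nat.centralBinom_eq_two_mul_choose] at key
    have h3 : 3 * (n + 1) ≤ 2 * (2 * n + 1) := by omega
    have : (n + 1) * (3 * (2 * n).choose n) ≤ (n + 1) * (2 * (n + 1)).choose (n + 1) := by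
      calc (n + 1) * (3 * (2 * n).choose n) = 3 * (n + 1) * (2 * n).choose n := by ring
        _ ≤ 2 * (2 * n + 1) * (2 * n).choose n := Nat.mul_le_mul_right _ h3
        _ = (n + 1) * (2 * (n + 1)).choose (n + 1) := key.symm
    exact Nat.le_of_mul_le_mul_left this (Nat.succ_pos n)
  exact hstep.trans (centralBinom_mono hnn')

/-- Level bookkeeping for the pull-back: with `N' ≥ 3N`, `N ≥ 1`, the size `N^a + 2 N N'` fits
level `max a 2` at the big frame: `N^a + 2 N N' ≤ N'^(max a 2)`. [folklore] -/
theorem level_budget {N N' a : ℕ} (hN : 1 ≤ N) (h3 : 3 * N ≤ N') :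
    N ^ a + 2 * N * N' ≤ N' ^ (max a 2) := by
  set M := max a 2 with hM
  have hM2 : 2 ≤ M := le_max_right _ _
  have hNN' : N ≤ N' := le_trans (by omega) h3
  have hN' : 1 ≤ N' := hN.trans hNN'
  have h1 : N ^ a ≤ N ^ M := Nat.pow_le_pow_right hN (le_max_left _ _)
  have h2 : N ^ M ≤ N' ^ (M - 2) * (N * N') := by
    have : N ^ M = N ^ (M - 2) * (N * N) := by
      rw [← pow_two, ← pow_add, Nat.sub_add_cancel hM2]
    rw [this]
    exact Nat.mul_le_mul (Nat.pow_le_pow_left hNN' _) (Nat.mul_le_mul_left _ hNN')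
  have h4 : 1 ≤ N' ^ (M - 2) := Nat.one_le_pow _ _ hN'
  have h3' : 2 * N * N' + N' ^ (M - 2) * (N * N') ≤ N' ^ M := by
    have eq : N' ^ M = N' ^ (M - 2) * (N' * N') := by
      rw [← pow_two, ← pow_add, Nat.sub_add_cancel hM2]
    rw [eq]
    calc 2 * N * N' + N' ^ (M - 2) * (N * N')
        ≤ N' ^ (M - 2) * (2 * N * N') + N' ^ (M - 2) * (N * N') := by
          have := Nat.le_mul_of_pos_left (2 * N * N') h4; omega
      _ = N' ^ (M - 2) * (3 * N * N') := by ring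
      _ ≤ N' ^ (M - 2) * (N' * N') := Nat.mul_le_mul_left _ (Nat.mul_le_mul_right _ h3)
  calc N ^ a + 2 * N * N' ≤ N' ^ (M - 2) * (N * N') + 2 * N * N' := Nat.add_le_add (h1.trans h2) le_rfl
    _ = 2 * N * N' + N' ^ (M - 2) * (N * N') := add_comm _ _
    _ ≤ N' ^ M := h3'

/-- **Natural proofs against `VP` ascend along projections.** Let the target family `h` carry an
algebraically natural proof of level `a` against `VP` (FSV regime: for every size exponent `b`,
infinitely often in `n`, a distinguisher of size and degree `≤ N^a` vanishing on
`SmallCircuits ℂ n b` and nonzero at `h_n`). Suppose every `h_n` is a Valiant projection of some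
member `P_{n'}` of a second family in a polynomially larger frame (`n < n' ≤ A (n+1)^B`,
`deg P_{n'} ≤ n'`). Then `P` carries a natural proof of level `max a 2` against `VP`: pull the
distinguisher back along the (linear) coefficient map of the substitution (`exists_pullback`); it
vanishes on `SmallCircuits ℂ n' b` because a projection of a size-`n'^b` polynomial has size
`≤ n'^b ≤ A^b (n+1)^{Bb}` and its window-`n` coefficients are those of its cheap truncation
(`Border.truncation_mem_smallCircuits`, BCS Lemma (21.25)), which lies in `SmallCircuits ℂ n (Bb+3)`
— where the original distinguisher is queried. (Contrapositive of "`VP` is closed under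
p-projections", at the level of algebraically natural proofs; GKSS 2017 §2, FSV 2018 §1.2.)
[cite: ForbesShpilkaVolk2018, Def. 1 and §1.2] [cite: Burgisser2000, Rem. 2.7] -/
theorem naturalProofAgainstVP_of_projections {a : ℕ} {h P : ∀ n, MvPolynomial (Fin n) ℂ}
    (hnat : NaturalProofAgainstVP ℂ a h)
    (hP : ∃ A B : ℕ, ∀ n : ℕ, ∃ n' : ℕ, n < n' ∧ n' ≤ A * (n + 1) ^ B ∧
      (P n').totalDegree ≤ n' ∧ IsProjection (h n) (P n')) :
    NaturalProofAgainstVP ℂ (max a 2) P := by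
  classical
  obtain ⟨A, B, hAB⟩ := hP
  intro b n₀'
  obtain ⟨n₁, hn₁⟩ := Border.truncation_budget (A ^ b) (B * b)
  obtain ⟨n, hn, D, ⟨hDmem, hD0, hvan⟩, hne⟩ := hnat (B * b + 3) (max n₁ (max n₀' 1))
  obtain ⟨n', hnn', hn'le, hPdeg, asub, hasub, hproj⟩ := hAB n
  obtain ⟨D', hD'eval, hD'size, hD'deg⟩ := exists_pullback asub D
  have hn1 : 1 ≤ n := le_trans (le_max_right _ _) ((le_max_right _ _).trans hn)
  have hN : 1 ≤ (2 * n).choose n := Nat.choose_pos (by omega)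
  have h3N : 3 * (2 * n).choose n ≤ (2 * n').choose n' := three_mul_centralBinom_le hn1 hnn'
  have hNN' : (2 * n).choose n ≤ (2 * n').choose n' := le_trans (by omega) h3N
  have hN' : 1 ≤ (2 * n').choose n' := hN.trans hNN'
  -- the value at `P n'`
  have hval : eval (coeffVector (degLEMonomials n') (P n')) D' =
      eval (coeffVector (degLEMonomials n) (h n)) D := by
    rw [hD'eval (P n') hPdeg, ← hproj]
  refine ⟨n', (le_max_left _ _).trans ((le_max_right _ _).trans hn) |>.trans hnn'.le, D',
    ⟨⟨?_, ?_⟩, ?_, ?_⟩, ?_⟩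
  · -- size
    calc complexity D' ≤ complexity D + 2 * (2 * n).choose n * (2 * n').choose n' := hD'size
      _ ≤ ((2 * n).choose n) ^ a + 2 * (2 * n).choose n * (2 * n').choose n' :=
          Nat.add_le_add_right hDmem.1 _
      _ ≤ ((2 * n').choose n') ^ (max a 2) := level_budget hN h3N
  · -- degree
    calc D'.totalDegree ≤ D.totalDegree := hD'deg
      _ ≤ ((2 * n).choose n) ^ a := hDmem.2
      _ ≤ ((2 * n').choose n') ^ a := Nat.pow_le_pow_left hNN' a
      _ ≤ ((2 * n').choose n') ^ (max a 2) := Nat.pow_le_pow_right hN' (le_max_left _ _)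
  · -- nonzero
    intro h0
    apply hne
    rw [← hval, h0, map_zero]
  · -- vanishing on `SmallCircuits ℂ n' b`
    intro f hf
    rw [hD'eval f hf.1, ← Border.coeffVector_truncation n (aeval asub f)]
    refine hvan _ (Border.truncation_mem_smallCircuits (R := A ^ b * (n + 1) ^ (B * b)) ?_
      (hn₁ n ((le_max_left _ _).trans hn)))
    calc complexity (aeval asub f) ≤ complexity f := complexity_le_of_isProjection ⟨asub, hasub, rfl⟩
      _ ≤ n' ^ b := hf.2
      _ ≤ (A * (n + 1) ^ B) ^ b := Nat.pow_le_pow_left hn'le b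
      _ = A ^ b * (n + 1) ^ (B * b) := by rw [mul_pow, ← pow_mul]
  · -- the value at `P n'` is nonzero
    rw [hval]
    exact hne

/-- Monotonicity of the technique class in the level. [cite: ForbesShpilkaVolk2018, Cor. 5] -/
theorem naturalProofAgainstVP_mono {a a' : ℕ} (haa' : a ≤ a') {h : ∀ n, MvPolynomial (Fin n) ℂ}
    (hnat : NaturalProofAgainstVP ℂ a h) : NaturalProofAgainstVP ℂ a' h := by
  intro b n₀
  obtain ⟨n, hn, D, hD, hne⟩ := hnat b n₀
  exact ⟨n, hn, D, isNaturalProof_mono (distinguishers_mono haa') hD, hne⟩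

end Transfer

end Projections

end Summit.ValiantsHypothesis.ValiantsHypothesis.Theorems.BarrierLever.NaturalProofsSeparateVNP

end
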